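import Literature.NumberTheory.LFunctions.TaoLogElliottCircleMethod
import Literature.NumberTheory.Sieve.ShiftedPrimePairs
import HarnessLib

/-!
# Tao's log-averaged Elliott theorem: Lemma 3.7 (few large frequencies), proved

Part of the proof DAG below the named fact `Literature.NumberTheory.LFunctions.Tao2016_theorem23_core` (Tao, Forum Math. Pi 4
(2016) e8, the proof of Theorem 2.3 from (2.10) on).  The last step of §3 of the paper is
**Lemma 3.7 (restriction theorem for the primes)**: the set `Ξ_H` of frequencies `ξ ∈ ℤ/Hℤ` at
which the prime exponential sum `S_H(-(b+h)η/a - hξ/H) = ∑_{p ∈ 𝒫_H} (c_p/p) e(·p)` is large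
(`≥ ε²/log H` for some `η ∈ ℤ/aℤ`) has size `≪_{a,h,ε} 1`.  The paper proves it from the
Green–Tao restriction estimate for the Selberg sieve, and notes in a footnote the alternative
route through the fourth moment: `∑_k |S_H(k/aH)|⁴` counts additive quadruples
`p₁ + p₂ = p₃ + p₄` in `𝒫_H`, "which may be upper bounded using a standard upper bound sieve".

This file assembles that route from two proved inputs of the tree:
* `Literature.NumberTheory.LFunctions.Tao2016.card_Xi_le` (`TaoLogElliottCircleMethod.lean`): Markov + the fourth moment,
  `#Ξ ≤ a N δ⁻⁴ p_min⁻⁴ · #{additive quadruples in 𝒫}`;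
* `Literature.NumberTheory.Sieve.ShiftedPrimePairs.exists_eventually_card_addQuadruples_le` (`Sieve/ShiftedPrimePairs.lean`):
  Brun's pure sieve, uniformly in the shift, gives for primes `𝒫 ⊆ [N/2, N]`
  `#{p₁ + p₃ = p₂ + p₄} ≤ C N (log log N)⁸ (log N)⁻² #𝒫²`.

Because the pure sieve loses powers of `log log`, the result is

  `#Ξ_H ≤ C · a · ε⁻¹⁰ · (log log H)⁸`      (`card_Xi_primesP_le`)

for `H` large (depending on `ε`), every `a ≥ 1` with `a ∣ H`, all integers `b`, `h ≠ 0` with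
`2|h|ε² < 1`, and all `1`-bounded phases `c_p` — instead of the printed `O_{a,h,ε}(1)`.  This is
harmless for the proof of Theorem 2.3: `Ξ_H` is only used through
`ε ≪_{a,h} ∑_{ξ ∈ Ξ_H} 𝔼 |H⁻¹ ∑_j g₁(a n + j) e(-jξ/H)| ≤ #Ξ_H · o_{H₋→∞}(1)`, where the `o(1)` is
the Matomäki–Radziwiłł–Tao rate `(log log H)/log H` of (2.10)–(2.12), which beats any power of
`log log H`.

## References
* T. Tao, *The logarithmically averaged Chowla and Elliott conjectures for two-point
  correlations*, Forum Math. Pi 4 (2016), e8; arXiv:1509.05422, §3, Lemma 3.7, its proof and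
  footnote, and the two displays preceding it.

## Design choices
* `Ξ_H` is `Literature.Tao2016.Xi (primesP ε H) c a H b h (ε² / log H)` exactly as in `lemma36` of
  `TaoLogElliottCircleMethod.lean` (Tao's parametrisation of the frequencies).
* Quantifiers: `∃ C > 0` absolute; then for fixed `a, b, h, ε` the bound holds `∀ᶠ H`, for all
  `H` divisible by `a` and all `1`-bounded `c`.
-/

open Finset Real Filter

namespace Literature.NumberTheory.LFunctions

namespace Tao2016

/-- **Tao 2016, Lemma 3.7 (few large frequencies), with a `(log log H)⁸` loss.**  There is an
absolute constant `C > 0` such that for all `a ≥ 1`, integers `b` and `h ≠ 0`, and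
`0 < ε ≤ 1` with `2|h|ε² < 1`: for all sufficiently large `H` divisible by `a` and all phases
`c_p` with `|c_p| ≤ 1` on `𝒫_H`,
`#Ξ_H ≤ C a ε⁻¹⁰ (log log H)⁸`, where `Ξ_H = {ξ ∈ ℤ/Hℤ : ∃ η ∈ ℤ/aℤ, |S_H(-(b+h)η/a - hξ/H)| ≥ ε²/log H}`
and `S_H(θ) = ∑_{p ∈ 𝒫_H} (c_p/p) e(θp)`.  (The paper: `|Ξ_H| ≪_{a,h,ε} 1` via the Green–Tao
restriction theorem; here via the footnote's fourth-moment route and Brun's sieve.)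
[cite: TaoFMP2016, Lemma 3.7 (and footnote)] -/
theorem card_Xi_primesP_le :
    ∃ C : ℝ, 0 < C ∧ ∀ (a : ℕ) (b h : ℤ), 0 < a → h ≠ 0 → ∀ ε : ℝ, 0 < ε → ε ≤ 1 →
      2 * |(h : ℝ)| * ε ^ 2 < 1 →
      ∀ᶠ H : ℕ in atTop, a ∣ H → ∀ c : ℕ → ℂ, (∀ p ∈ primesP ε H, ‖c p‖ ≤ 1) →
        ((Xi (primesP ε H) c a H b h (ε ^ 2 / Real.log H)).card : ℝ) ≤
          C * a * ε⁻¹ ^ 10 * Real.log (Real.log H) ^ 8 := by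
  obtain ⟨C₀, hC₀, hev⟩ := Sieve.ShiftedPrimePairs.exists_eventually_card_addQuadruples_le
  refine ⟨576 * C₀, by positivity, ?_⟩
  intro a b h ha hh ε hε hε1 hhε
  obtain ⟨N₀, hN₀⟩ := Filter.eventually_atTop.mp hev
  -- largeness conditions on `H`
  have c1 : ∀ᶠ H : ℕ in atTop, (4 : ℝ) ≤ ε ^ 4 * H :=
    (tendsto_natCast_atTop_atTop.const_mul_atTop (by positivity : 0 < ε ^ 4)).eventually_ge_atTop 4
  have c2 : ∀ᶠ H : ℕ in atTop, (N₀ : ℝ) + 1 ≤ ε ^ 2 * H :=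
    (tendsto_natCast_atTop_atTop.const_mul_atTop (by positivity : 0 < ε ^ 2)).eventually_ge_atTop _
  have c3 : ∀ᶠ H : ℕ in atTop, (16 : ℝ) ≤ H := tendsto_natCast_atTop_atTop.eventually_ge_atTop 16
  filter_upwards [c1, c2, c3] with H hH4 hHN₀ hH16 haH c hc
  -- notation and basic facts
  have hε2 : 0 < ε ^ 2 := by positivity
  have hH0 : (0 : ℝ) < H := by linarith
  have hHpos : 0 < H := by exact_mod_cast hH0
  have hlogH : 0 < Real.log H := Real.log_pos (by linarith)
  have hlogH1 : 1 ≤ Real.log H := by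
    rw [← Real.log_exp 1]
    exact Real.log_le_log (Real.exp_pos 1) (by have := Real.exp_one_lt_d9; linarith)
  set y : ℝ := ε ^ 2 * H with hy
  set N : ℕ := ⌊y⌋₊ with hN
  have hy4 : 4 ≤ y := by
    have : ε ^ 4 * H ≤ ε ^ 2 * H := by
      have : ε ^ 4 ≤ ε ^ 2 := by nlinarith [pow_le_one₀ hε.le hε1 (n := 2)]
      nlinarith
    linarith
  have hNy : (N : ℝ) ≤ y := Nat.floor_le (by linarith)
  have hyN : y < N + 1 := Nat.lt_floor_add_one y
  have hN₀N : N₀ ≤ N := by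
    have : (N₀ : ℝ) ≤ N := by linarith
    exact_mod_cast this
  have hNH : (N : ℝ) ≤ H := hNy.trans (by nlinarith [pow_le_one₀ hε.le hε1 (n := 2)])
  have hN3 : (3 : ℝ) ≤ N := by linarith
  have hN0 : (0 : ℝ) < N := by linarith
  -- `log N ≥ (log H)/2`: `N ≥ y - 1 ≥ y/2 ≥ √H` as `ε⁴ H ≥ 4`
  have hsqrt : Real.sqrt H ≤ N := by
    have h1 : Real.sqrt H ≤ y / 2 := by
      rw [Real.sqrt_le_left (by linarith)]
      have : (y / 2) ^ 2 = ε ^ 4 * H * H / 4 := by rw [hy]; ring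
      rw [this]
      nlinarith
    linarith
  have hlogN : Real.log H / 2 ≤ Real.log N := by
    have := Real.log_le_log (Real.sqrt_pos.2 hH0) hsqrt
    rwa [Real.log_sqrt hH0.le] at this
  have hlogN0 : 0 < Real.log N := by linarith
  have hloglog : Real.log (Real.log N) ≤ Real.log (Real.log H) :=
    Real.log_le_log hlogN0 (Real.log_le_log hN0 hNH)
  have hloglog0 : 0 ≤ Real.log (Real.log N) := Real.log_nonneg (by
    -- `log N ≥ log 3 > 1`
    have : Real.log 3 ≤ Real.log N := Real.log_le_log (by norm_num) hN3
    have h3 : 1 < Real.log 3 := by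
      rw [← Real.log_exp 1]
      exact Real.log_lt_log (Real.exp_pos 1) (by have := Real.exp_one_lt_d9; linarith)
    linarith)
  -- the energy bound at `N = ⌊ε² H⌋`
  have hP : ∀ p ∈ primesP ε H, p.Prime ∧ (N : ℝ) ≤ 2 * p ∧ p ≤ N := by
    intro p hp
    obtain ⟨hpp, hp1, hp2⟩ := mem_primesP.1 hp
    refine ⟨hpp, by linarith, Nat.le_floor hp2⟩
  have hE := hN₀ N hN₀N (primesP ε H) hP
  -- Chebyshev
  obtain ⟨hcard, -⟩ := card_primesP_le hε hε1 hH4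
  -- the fourth-moment bound
  obtain ⟨H', hH'⟩ := haH
  have hH'pos : 0 < H' := by
    rcases Nat.eq_zero_or_pos H' with h0 | h0
    · rw [h0, mul_zero] at hH'; omega
    · exact h0
  set pmin : ℕ := ⌈y / 2⌉₊ with hpmin
  have hpmin0 : 0 < pmin := Nat.ceil_pos.2 (by linarith)
  have hpminR : y / 2 ≤ pmin := Nat.le_ceil _
  have hPmm : ∀ p ∈ primesP ε H, pmin ≤ p ∧ p ≤ N := by
    intro p hp
    obtain ⟨-, hp1, hp2⟩ := mem_primesP.1 hp
    exact ⟨Nat.ceil_le.2 hp1, Nat.le_floor hp2⟩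
  have hsmall : 2 * |h| * (N : ℤ) < H := by
    have h1 : 2 * |(h : ℝ)| * N < H := by
      calc 2 * |(h : ℝ)| * N ≤ 2 * |(h : ℝ)| * y := by gcongr
        _ = (2 * |(h : ℝ)| * ε ^ 2) * H := by rw [hy]; ring
        _ < 1 * H := by gcongr
        _ = H := one_mul _
    have h2 : ((2 * |h| * (N : ℤ) : ℤ) : ℝ) < ((H : ℤ) : ℝ) := by push_cast; exact h1
    exact_mod_cast h2
  have hδ : 0 < ε ^ 2 / Real.log H := by positivity
  have hXi := card_Xi_le ha hH'pos hH' b h hh (primesP ε H) c hc hpmin0 hPmm hsmall hδ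
  -- combine
  have hcardP : ((primesP ε H).card : ℝ) ^ 2 ≤ (3 * y / Real.log H) ^ 2 := by
    have h0 : 0 ≤ ((primesP ε H).card : ℝ) := Nat.cast_nonneg _
    have : ((primesP ε H).card : ℝ) ≤ 3 * y / Real.log H := by rw [hy]; simpa [mul_div_assoc] using hcard
    exact pow_le_pow_left₀ h0 this 2
  have hE' : ((addQuadruples (primesP ε H)).card : ℝ) ≤
      C₀ * y * Real.log (Real.log H) ^ 8 / (Real.log H / 2) ^ 2 * (3 * y / Real.log H) ^ 2 := by
    refine hE.trans ?_
    have h1 : C₀ * N * Real.log (Real.log N) ^ 8 / Real.log N ^ 2 ≤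
        C₀ * y * Real.log (Real.log H) ^ 8 / (Real.log H / 2) ^ 2 := by
      have hnum : C₀ * N * Real.log (Real.log N) ^ 8 ≤ C₀ * y * Real.log (Real.log H) ^ 8 := by
        have := pow_le_pow_left₀ hloglog0 hloglog 8
        have h0 : 0 ≤ Real.log (Real.log H) ^ 8 := by positivity
        nlinarith [mul_le_mul hNy this (by positivity) (by linarith : (0 : ℝ) ≤ y)]
      have hden : (Real.log H / 2) ^ 2 ≤ Real.log N ^ 2 :=
        pow_le_pow_left₀ (by positivity) hlogN 2
      exact div_le_div₀ (by positivity) hnum (by positivity) hden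
    have h2 : 0 ≤ C₀ * y * Real.log (Real.log H) ^ 8 / (Real.log H / 2) ^ 2 := by positivity
    exact mul_le_mul h1 hcardP (by positivity) h2
  have hδinv : (ε ^ 2 / Real.log H)⁻¹ ^ 4 = Real.log H ^ 4 / ε ^ 8 := by
    rw [inv_div, div_pow]; ring
  have hpmin_inv : ((pmin : ℝ)⁻¹) ^ 4 ≤ (2 / y) ^ 4 := by
    refine pow_le_pow_left₀ (by positivity) ?_ 4
    rw [inv_eq_one_div, div_le_div_iff₀ (by exact_mod_cast hpmin0) (by linarith)]
    linarith
  calc ((Xi (primesP ε H) c a H b h (ε ^ 2 / Real.log H)).card : ℝ)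
      ≤ a * H * (ε ^ 2 / Real.log H)⁻¹ ^ 4 * ((pmin : ℝ)⁻¹) ^ 4 *
          (addQuadruples (primesP ε H)).card := hXi
    _ ≤ a * H * (Real.log H ^ 4 / ε ^ 8) * (2 / y) ^ 4 *
          (C₀ * y * Real.log (Real.log H) ^ 8 / (Real.log H / 2) ^ 2 * (3 * y / Real.log H) ^ 2) := by
        rw [hδinv]
        have h0 : 0 ≤ (a : ℝ) * H * (Real.log H ^ 4 / ε ^ 8) := by positivity
        exact mul_le_mul (mul_le_mul_of_nonneg_left hpmin_inv h0) hE' (Nat.cast_nonneg _)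
          (by positivity)
    _ = 576 * C₀ * a * ε⁻¹ ^ 10 * Real.log (Real.log H) ^ 8 := by
        rw [hy]
        field_simp
        ring

end Tao2016

end Literature.NumberTheory.LFunctions
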